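import Summits.ValiantsHypothesis.ValiantsHypothesis.Theorems.RigidityForcesSymmetryGrenetFirstOrderRankRigidGapBorders

/-!
# Route RigidityForcesSymmetry — `GrenetFirstOrderRankRigid` (item stmt-ValiantsHypothesis-21029),
line `grenet_gauge`: stub `stub_linearRigid`, step 5 (blocks III / I<, part 5) — the deliverables

For the crux line `Cruxes/GrenetFirstOrderRankRigid/Lines/grenet_gauge.lean` (blueprint
`Lines/grenet_gauge-stub_linearRigid-PROOF.md`, §5; interface `Lines/grenet_gauge-stub_linearRigid-BLOCKS.md`).
The deliverables (D-PQ), (D-tail), (D-head), (D-Q0), (D-P0) for the types III (`U ⊆ T`) and I<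
(`|U \ T| < |T \ U|`) with the TYPE hypotheses of the interface, reduced to the gap theorems of
`…GapBlocks` / `…GapBorders` (`|U| < |T|`; for type III the strictness `U ≠ T` comes from the genuineness
of the entry, for type I< no genuineness is needed):
`grenet_III_PQ`, `grenet_III_Q0`, `grenet_III_P0`, `grenet_III_tail`, `grenet_III_head`,
`grenet_Ilt_PQ`, `grenet_Ilt_tail`, `grenet_Ilt_head`.

No new definitions.  VP ≠ VNP is not moved by this file (first-order bookkeeping about one matrix
family).
-/

noncomputable section

open MvPolynomial Matrix Finset

namespace Summit.ValiantsHypothesis.Theorems.RigidityForcesSymmetry.GrenetGauge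

open Literature.Computability.AlgebraicComplexity

/-! ### The deliverables with the TYPE hypotheses of the interface -/

section Deliverables

variable {k : Type*} [CommRing k] [IsDomain k] {n N : ℕ} (e : Finset (Fin n) ≃ Fin (N + 1))
  (hn : n ≠ 0) (hN : 2 ^ n = N + 1) (A' : Fin n × Fin n → Matrix (Fin N) (Fin N) k)
  (htr : ((Grenet.repr k n e).adjugate * ∑ v, (X v : MvPolynomial (Fin n × Fin n) k) • (A' v).map C).trace = 0)

include hn hN htr

/-- **(D-PQ), type III** (`U ⊆ T`; genuine tail entry, head entry). [cite: Grenet2011, Thm. 1] -/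
theorem grenet_III_PQ {i j : Fin N} {v : Fin n × Fin n} {i' j' : Fin N} {v' : Fin n × Fin n}
    (htail : v.1 ∉ e.symm ((e univ).succAbove i) ∧ (v.2 : ℕ) = (e.symm ((e univ).succAbove i)).card)
    (hgen : ¬ (v.1 ∈ e.symm ((e ∅).succAbove j) ∧ (e.symm ((e ∅).succAbove j)).card = (v.2 : ℕ) + 1))
    (hhead : v'.1 ∈ e.symm ((e ∅).succAbove j') ∧ (e.symm ((e ∅).succAbove j')).card = (v'.2 : ℕ) + 1)
    (hU : insert v.1 (e.symm ((e univ).succAbove i)) = e.symm ((e univ).succAbove i'))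
    (hT : e.symm ((e ∅).succAbove j) = (e.symm ((e ∅).succAbove j')).erase v'.1)
    (hIII : insert v.1 (e.symm ((e univ).succAbove i)) ⊆ e.symm ((e ∅).succAbove j)) :
    A' v' i' j' = -A' v i j := by
  refine grenet_gap_PQ e hn hN A' htr htail hhead hU hT ?_
  rw [← hU]
  refine Finset.card_lt_card (Finset.ssubset_iff_subset_ne.mpr ⟨hIII, fun hUT => hgen ?_⟩)
  refine ⟨hUT ▸ Finset.mem_insert_self _ _, ?_⟩
  rw [← hUT, Finset.card_insert_of_notMem htail.1, htail.2]

/-- **(D-PQ), type I<** (`|U \ T| < |T \ U|`; tail entry, head entry). [cite: Grenet2011, Thm. 1] -/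
theorem grenet_Ilt_PQ {i j : Fin N} {v : Fin n × Fin n} {i' j' : Fin N} {v' : Fin n × Fin n}
    (htail : v.1 ∉ e.symm ((e univ).succAbove i) ∧ (v.2 : ℕ) = (e.symm ((e univ).succAbove i)).card)
    (hhead : v'.1 ∈ e.symm ((e ∅).succAbove j') ∧ (e.symm ((e ∅).succAbove j')).card = (v'.2 : ℕ) + 1)
    (hU : insert v.1 (e.symm ((e univ).succAbove i)) = e.symm ((e univ).succAbove i'))
    (hT : e.symm ((e ∅).succAbove j) = (e.symm ((e ∅).succAbove j')).erase v'.1)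
    (hIlt : (insert v.1 (e.symm ((e univ).succAbove i)) \ e.symm ((e ∅).succAbove j)).card <
      (e.symm ((e ∅).succAbove j) \ insert v.1 (e.symm ((e univ).succAbove i))).card) :
    A' v' i' j' = -A' v i j := by
  refine grenet_gap_PQ e hn hN A' htr htail hhead hU hT ?_
  rw [← hU]
  have h1 := Finset.card_sdiff_add_card_inter (insert v.1 (e.symm ((e univ).succAbove i))) (e.symm ((e ∅).succAbove j))
  have h2 := Finset.card_sdiff_add_card_inter (e.symm ((e ∅).succAbove j)) (insert v.1 (e.symm ((e univ).succAbove i)))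
  rw [Finset.inter_comm] at h2
  omega

/-- **(D-Q0), type III**: a genuine tail entry with column vertex `univ` vanishes. [cite: Grenet2011, Thm. 1] -/
theorem grenet_III_Q0 {i j : Fin N} {v : Fin n × Fin n}
    (htail : v.1 ∉ e.symm ((e univ).succAbove i) ∧ (v.2 : ℕ) = (e.symm ((e univ).succAbove i)).card)
    (hgen : ¬ (v.1 ∈ e.symm ((e ∅).succAbove j) ∧ (e.symm ((e ∅).succAbove j)).card = (v.2 : ℕ) + 1))
    (hTu : e.symm ((e ∅).succAbove j) = univ) :
    A' v i j = 0 := by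
  refine grenet_gap_Q0 e hn hN A' htr htail hTu ?_
  have hUne : insert v.1 (e.symm ((e univ).succAbove i)) ≠ univ := fun hU =>
    hgen ⟨hTu ▸ Finset.mem_univ _, by rw [hTu, ← hU, Finset.card_insert_of_notMem htail.1, htail.2]⟩
  have h := (Finset.card_lt_iff_ne_univ _).mpr hUne
  rwa [Fintype.card_fin] at h

/-- **(D-P0), type III**: a genuine head entry with row vertex `∅` vanishes. [cite: Grenet2011, Thm. 1] -/
theorem grenet_III_P0 {i j : Fin N} {v : Fin n × Fin n}
    (hhead : v.1 ∈ e.symm ((e ∅).succAbove j) ∧ (e.symm ((e ∅).succAbove j)).card = (v.2 : ℕ) + 1)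
    (hgen : ¬ (v.1 ∉ e.symm ((e univ).succAbove i) ∧ (v.2 : ℕ) = (e.symm ((e univ).succAbove i)).card))
    (hS0 : e.symm ((e univ).succAbove i) = ∅) :
    A' v i j = 0 := by
  refine grenet_gap_P0 e hn hN A' htr hhead hS0 fun hT0 => hgen ⟨hS0 ▸ Finset.notMem_empty _, ?_⟩
  have h1 := Finset.card_erase_of_mem hhead.1
  rw [hT0, Finset.card_empty] at h1
  rw [hS0, Finset.card_empty]
  omega

/-- **(D-tail), type III** (`U ⊆ T`; two genuine tail entries of the same pair). [cite: Grenet2011, Thm. 1] -/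
theorem grenet_III_tail {i j : Fin N} {v : Fin n × Fin n} {i₂ : Fin N} {v₂ : Fin n × Fin n}
    (htail : v.1 ∉ e.symm ((e univ).succAbove i) ∧ (v.2 : ℕ) = (e.symm ((e univ).succAbove i)).card)
    (hgen : ¬ (v.1 ∈ e.symm ((e ∅).succAbove j) ∧ (e.symm ((e ∅).succAbove j)).card = (v.2 : ℕ) + 1))
    (htail₂ : v₂.1 ∉ e.symm ((e univ).succAbove i₂) ∧ (v₂.2 : ℕ) = (e.symm ((e univ).succAbove i₂)).card)
    (hgen₂ : ¬ (v₂.1 ∈ e.symm ((e ∅).succAbove j) ∧ (e.symm ((e ∅).succAbove j)).card = (v₂.2 : ℕ) + 1))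
    (hUU : insert v.1 (e.symm ((e univ).succAbove i)) = insert v₂.1 (e.symm ((e univ).succAbove i₂)))
    (hIII : insert v.1 (e.symm ((e univ).succAbove i)) ⊆ e.symm ((e ∅).succAbove j)) :
    A' v i j = A' v₂ i₂ j := by
  by_cases hTu : e.symm ((e ∅).succAbove j) = univ
  · rw [grenet_III_Q0 e hn hN A' htr htail hgen hTu, grenet_III_Q0 e hn hN A' htr htail₂ hgen₂ hTu]
  · refine grenet_gap_tail e hn hN A' htr htail htail₂ hUU ?_ hTu
    refine Finset.card_lt_card (Finset.ssubset_iff_subset_ne.mpr ⟨hIII, fun hUT => hgen ?_⟩)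
    refine ⟨hUT ▸ Finset.mem_insert_self _ _, ?_⟩
    rw [← hUT, Finset.card_insert_of_notMem htail.1, htail.2]

/-- **(D-tail), type I<** (`0 < |U \ T| < |T \ U|`; two tail entries of the same pair). [cite: Grenet2011, Thm. 1] -/
theorem grenet_Ilt_tail {i j : Fin N} {v : Fin n × Fin n} {i₂ : Fin N} {v₂ : Fin n × Fin n}
    (htail : v.1 ∉ e.symm ((e univ).succAbove i) ∧ (v.2 : ℕ) = (e.symm ((e univ).succAbove i)).card)
    (htail₂ : v₂.1 ∉ e.symm ((e univ).succAbove i₂) ∧ (v₂.2 : ℕ) = (e.symm ((e univ).succAbove i₂)).card)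
    (hUU : insert v.1 (e.symm ((e univ).succAbove i)) = insert v₂.1 (e.symm ((e univ).succAbove i₂)))
    (hIlt : 0 < (insert v.1 (e.symm ((e univ).succAbove i)) \ e.symm ((e ∅).succAbove j)).card ∧
      (insert v.1 (e.symm ((e univ).succAbove i)) \ e.symm ((e ∅).succAbove j)).card <
        (e.symm ((e ∅).succAbove j) \ insert v.1 (e.symm ((e univ).succAbove i))).card) :
    A' v i j = A' v₂ i₂ j := by
  have hTu : e.symm ((e ∅).succAbove j) ≠ univ := fun hTu => by
    have h0 : (insert v.1 (e.symm ((e univ).succAbove i)) \ e.symm ((e ∅).succAbove j)).card = 0 := by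
      rw [hTu, Finset.sdiff_eq_empty_iff_subset.mpr (Finset.subset_univ _), Finset.card_empty]
    omega
  refine grenet_gap_tail e hn hN A' htr htail htail₂ hUU ?_ hTu
  have h1 := Finset.card_sdiff_add_card_inter (insert v.1 (e.symm ((e univ).succAbove i))) (e.symm ((e ∅).succAbove j))
  have h2 := Finset.card_sdiff_add_card_inter (e.symm ((e ∅).succAbove j)) (insert v.1 (e.symm ((e univ).succAbove i)))
  rw [Finset.inter_comm] at h2
  omega

/-- **(D-head), type III** (`S ⊆ T - p`; two genuine head entries of the same pair). [cite: Grenet2011, Thm. 1] -/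
theorem grenet_III_head {i j : Fin N} {v : Fin n × Fin n} {j₂ : Fin N} {v₂ : Fin n × Fin n}
    (hhead : v.1 ∈ e.symm ((e ∅).succAbove j) ∧ (e.symm ((e ∅).succAbove j)).card = (v.2 : ℕ) + 1)
    (hgen : ¬ (v.1 ∉ e.symm ((e univ).succAbove i) ∧ (v.2 : ℕ) = (e.symm ((e univ).succAbove i)).card))
    (hhead₂ : v₂.1 ∈ e.symm ((e ∅).succAbove j₂) ∧ (e.symm ((e ∅).succAbove j₂)).card = (v₂.2 : ℕ) + 1)
    (hgen₂ : ¬ (v₂.1 ∉ e.symm ((e univ).succAbove i) ∧ (v₂.2 : ℕ) = (e.symm ((e univ).succAbove i)).card))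
    (hRR : (e.symm ((e ∅).succAbove j)).erase v.1 = (e.symm ((e ∅).succAbove j₂)).erase v₂.1)
    (hIII : e.symm ((e univ).succAbove i) ⊆ (e.symm ((e ∅).succAbove j)).erase v.1) :
    A' v i j = A' v₂ i j₂ := by
  by_cases hS0 : e.symm ((e univ).succAbove i) = ∅
  · rw [grenet_III_P0 e hn hN A' htr hhead hgen hS0, grenet_III_P0 e hn hN A' htr hhead₂ hgen₂ hS0]
  · refine grenet_gap_head e hn hN A' htr hhead hhead₂ hRR ?_ hS0
    refine Finset.card_lt_card (Finset.ssubset_iff_subset_ne.mpr ⟨hIII, fun hST => hgen ?_⟩)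
    refine ⟨hST ▸ Finset.notMem_erase _ _, ?_⟩
    have h1 := Finset.card_erase_of_mem hhead.1
    rw [← hST] at h1
    omega

/-- **(D-head), type I<** (`0 < |S \ (T - p)| < |(T - p) \ S|`; two head entries of the same pair).
[cite: Grenet2011, Thm. 1] -/
theorem grenet_Ilt_head {i j : Fin N} {v : Fin n × Fin n} {j₂ : Fin N} {v₂ : Fin n × Fin n}
    (hhead : v.1 ∈ e.symm ((e ∅).succAbove j) ∧ (e.symm ((e ∅).succAbove j)).card = (v.2 : ℕ) + 1)
    (hhead₂ : v₂.1 ∈ e.symm ((e ∅).succAbove j₂) ∧ (e.symm ((e ∅).succAbove j₂)).card = (v₂.2 : ℕ) + 1)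
    (hRR : (e.symm ((e ∅).succAbove j)).erase v.1 = (e.symm ((e ∅).succAbove j₂)).erase v₂.1)
    (hIlt : 0 < (e.symm ((e univ).succAbove i) \ (e.symm ((e ∅).succAbove j)).erase v.1).card ∧
      (e.symm ((e univ).succAbove i) \ (e.symm ((e ∅).succAbove j)).erase v.1).card <
        ((e.symm ((e ∅).succAbove j)).erase v.1 \ e.symm ((e univ).succAbove i)).card) :
    A' v i j = A' v₂ i j₂ := by
  have hS0 : e.symm ((e univ).succAbove i) ≠ ∅ := fun hS0 => by
    have h0 : (e.symm ((e univ).succAbove i) \ (e.symm ((e ∅).succAbove j)).erase v.1).card = 0 := by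
      rw [hS0, Finset.empty_sdiff, Finset.card_empty]
    omega
  refine grenet_gap_head e hn hN A' htr hhead hhead₂ hRR ?_ hS0
  have h1 := Finset.card_sdiff_add_card_inter (e.symm ((e univ).succAbove i)) ((e.symm ((e ∅).succAbove j)).erase v.1)
  have h2 := Finset.card_sdiff_add_card_inter ((e.symm ((e ∅).succAbove j)).erase v.1) (e.symm ((e univ).succAbove i))
  rw [Finset.inter_comm] at h2
  omega

end Deliverables

end Summit.ValiantsHypothesis.Theorems.RigidityForcesSymmetry.GrenetGauge
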